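import Summits.AnomalousDissipation.AnomalousDissipation.Theorems.SolenoidalFractalHomogenisationLagrangianStepSidebandLadderInvariant
import Summits.AnomalousDissipation.AnomalousDissipation.Theorems.SolenoidalFractalHomogenisationLagrangianStepSidebandLadderOdd
import HarnessLib

/-!
# K1L_D `stub_D1_V0thg` (stmt-AnomalousDissipation-27980), R3′ lane «SidebandTailCrushing» (tenure D28-16 (3) / D28-20) — file F4h:
# LADDER CRUSH — `ladder_decay` with its two structural hypotheses discharged (ladder invariance F4f, odd allowance F4g)

Helper file of route `SolenoidalFractalHomogenisation` (prover seat `ad-k1l-cellLawV-w1` g10; `--supports stmt-AnomalousDissipation-27980 --as helper`).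
`ladder_crush` = `Sideband.ladder_decay` ∘ `Sideband.mem_ladderSub_of_flow` ∘ `Sideband.ladder_odd_allowance`: a solution of `u′ = gen(t) u` on
`[t₀, t₁]` inside slot `i` (other envelopes off, `envᵢ ∈ [Gm, GM]`, `Gm ≥ 0`) that STARTS in the ladder subspace of a hopping ladder `z₀ + ℤmᵢ`
(`êᵢ·z₀ ≠ 0`, box radius `R > M ≥ ‖mᵢ‖_∞`), under `NearIso 𝔸 lo' hi'` (`lo', hi' > 0`), `OddSmall 𝔸 βo` (`βo ≥ 0`), `γ₁ ≥ 0`, satisfies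
`‖u t₁‖² ≤ 3(1 + α/(2δ₁·4π²lo'/7))·exp(−lam(t₁−t₀−δ₁))·‖u t₀‖²` for all parameters `α, β > 0`, `lam ≥ 0`, `ε, s, s' > 0`, `0 < δ₁ ≤ t₁−t₀` obeying the
twelve polynomial constraints P1–P8, P4c, P4d written with the explicit ladder constants (`η₂, η₃` of h6 now explicit in `βo/lo'`, `s`, `s'`).
What is left for the consumer (file F5 / R3′-2, not here): the CHOICE of the parameters as powers of `ν` (`β ~ (Gm lo₁/(2S²GM²))^{1/3}`, `α = Sβ²`,
`lam ~ lo₁^{2/3}`) and the slot bookkeeping.  No definitions, no sorry.  NOT a proof of `stub_D1_V0thg`, of K1L_D or of AD; rung F-D1.A0 infrastructure.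
-/

set_option linter.dupNamespace false -- single-conjunct summit: `Summit.AnomalousDissipation.AnomalousDissipation.…` is the mandated namespace

noncomputable section

namespace Summit.AnomalousDissipation.AnomalousDissipation.Theorems.SolenoidalFractalHomogenisation.LagrangianStep.Sideband

open Set Complex
open scoped InnerProductSpace
open Literature.Analysis Literature.Analysis.FunctionSpaces Literature.Analysis.FunctionSpaces.Torus
open Literature.Analysis.FluidPDE Literature.Analysis.FluidPDE.Torus Literature.Analysis.FluidPDE.LatticeShear

variable {k₀ : ℕ}

set_option maxHeartbeats 400000 in -- pre-budgeted (ops-buildfix rule): large statement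
/-- **LADDER CRUSH** — hypocoercive decay of a solution of the truncated sideband system on a hopping ladder during one slot, from an initial
state in the ladder subspace, under `NearIso`/`OddSmall`; all constants explicit (see the module docstring; constraints as in
`LadderCrush.hypocoercive_decay''` with `lo₁ = 4π²lo'/7`, `A = 4a²`, `CJ = 8a²(1+|mᵢ|²)|hi'|/lo'`, `η₀ = GM·2a²·3/((R−M)4π²lo')`, `η₁ = 0`,
`η₂ = βo/(2lo')·(s⁻¹ + 8a²(1+|mᵢ|²)s')`, `η₃ = βo/(2lo')·(8a²(1+|mᵢ|²)s + s'⁻¹)`, `U₁,₂,₃` from `coercive_ladder`, `a = 2π|Σ eᵢ z₀|‖αᵢ‖`).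
[cite: BedrossianCotiZelati2017, §2 (hypocoercivity, enhanced dissipation)] [cite: Avron1998OddViscosity, §2 eq. (1)-(2)] -/
theorem ladder_crush (W₁ : LatticeWord k₀) {R : ℕ} (i : Fin k₀) (z₀ : Fin 3 → ℤ)
    (hhop : ∑ a, (W₁.phase i).e a * (z₀ a : ℝ) ≠ 0) {M : ℝ} (hM : ∀ j, |((W₁.phase i).m j : ℝ)| ≤ M) (hMR : M < R)
    {𝔸 : Torus.Visc4 (Fin 3)} {lo' hi' : ℝ} (h𝔸 : Torus.NearIso 𝔸 lo' hi') (hlo' : 0 < lo') (hhi : 0 < hi') {βo : ℝ} (hoddA : Torus.OddSmall 𝔸 βo)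
    (hβo : 0 ≤ βo) {γ₁ : ℝ} (hγ₁ : 0 ≤ γ₁)
    {u : ℝ → Space R} {t₀ t₁ δ₁ : ℝ} (hδ : 0 < δ₁) (hδt : t₀ + δ₁ ≤ t₁)
    (hu : ∀ t ∈ Icc t₀ t₁, HasDerivAt u (((gen W₁ 𝔸 γ₁ R t).restrictScalars ℝ) (u t)) t)
    (h0 : u t₀ ∈ ladderSub R (ladder z₀ (W₁.phase i).m))
    (hoff : ∀ t ∈ Icc t₀ t₁, ∀ j, j ≠ i → slotEnvelope W₁ j t = 0)
    {Gm GM : ℝ} (hG : ∀ t ∈ Icc t₀ t₁, Gm ≤ slotEnvelope W₁ i t ∧ slotEnvelope W₁ i t ≤ GM) (hGm : 0 ≤ Gm)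
    {s s' : ℝ} (hs : 0 < s) (hs' : 0 < s')
    {α β lam ε : ℝ} (hα : 0 < α) (hβ : 0 < β) (hlam : 0 ≤ lam) (hε : 0 < ε)
    (P1 : 4 * (4 * (2 * Real.pi * |∑ a, (W₁.phase i).e a * (z₀ a : ℝ)| * ‖slotAmp W₁ i‖) ^ 2) * β ^ 2 ≤ α)
    (P2 : 16 * (8 * (2 * Real.pi * |∑ a, (W₁.phase i).e a * (z₀ a : ℝ)| * ‖slotAmp W₁ i‖) ^ 2 * (1 + freqNormSq (W₁.phase i).m) * |hi'| / lo') * β ^ 2 ≤ α)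
    (P3 : 2 * α ^ 2 * GM ^ 2 ≤ β * Gm * (4 * Real.pi ^ 2 * lo' / 7))
    (P4 : 16 * β * (GM * (2 * (2 * Real.pi * |∑ a, (W₁.phase i).e a * (z₀ a : ℝ)| * ‖slotAmp W₁ i‖) ^ 2 * 3 / (((R : ℝ) - M) * (4 * Real.pi ^ 2 * lo')))) ≤ 1)
    (P4c : 16 * β * (βo / (2 * lo') * (s⁻¹ + 8 * (2 * Real.pi * |∑ a, (W₁.phase i).e a * (z₀ a : ℝ)| * ‖slotAmp W₁ i‖) ^ 2 * (1 + freqNormSq (W₁.phase i).m) * s')) ≤ 1)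
    (P4d : 8 * β * (βo / (2 * lo') * (8 * (2 * Real.pi * |∑ a, (W₁.phase i).e a * (z₀ a : ℝ)| * ‖slotAmp W₁ i‖) ^ 2 * (1 + freqNormSq (W₁.phase i).m) * s + s'⁻¹)) ≤ α)
    (P5 : 6 * lam * α ≤ 4 * Real.pi ^ 2 * lo' / 7)
    (P6 : 6 * lam * ((1 + freqNormSq (W₁.phase i).m) / (4 * (2 * Real.pi * |∑ a, (W₁.phase i).e a * (z₀ a : ℝ)| * ‖slotAmp W₁ i‖) ^ 2) * (2 * ε))
      ≤ 4 * Real.pi ^ 2 * lo' / 7)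
    (P7 : 6 * lam * ((1 + freqNormSq (W₁.phase i).m) / (4 * (2 * Real.pi * |∑ a, (W₁.phase i).e a * (z₀ a : ℝ)| * ‖slotAmp W₁ i‖) ^ 2) *
      (2 * (2 * Real.pi * |∑ a, (W₁.phase i).e a * (z₀ a : ℝ)| * ‖slotAmp W₁ i‖) ^ 2 * 3 / (((R : ℝ) - M) * (4 * Real.pi ^ 2 * lo')) +
        4 * (2 * Real.pi * |∑ a, (W₁.phase i).e a * (z₀ a : ℝ)| * ‖slotAmp W₁ i‖) ^ 2 / (4 * Real.pi ^ 2 * lo' * ((R : ℝ) - M) ^ 2))) ≤ 1)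
    (P8 : 3 * lam * ((1 + freqNormSq (W₁.phase i).m) / (4 * (2 * Real.pi * |∑ a, (W₁.phase i).e a * (z₀ a : ℝ)| * ‖slotAmp W₁ i‖) ^ 2) *
      (2 + 2 * (2 * Real.pi * |∑ a, (W₁.phase i).e a * (z₀ a : ℝ)| * ‖slotAmp W₁ i‖) ^ 2 / ε)) ≤ 2 * β * Gm) :
    ‖u t₁‖ ^ 2 ≤ 3 * (1 + α / (2 * δ₁ * (4 * Real.pi ^ 2 * lo' / 7))) * Real.exp (-(lam * (t₁ - t₀ - δ₁))) * ‖u t₀‖ ^ 2 :=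
  ladder_decay W₁ i z₀ hhop hM hMR h𝔸 hlo' hhi hγ₁ hδ hδt hu
    (mem_ladderSub_of_flow W₁ i z₀ h𝔸 hlo'.le hγ₁ hu hoff h0) hoff hG hGm
    (fun _ hy => ladder_odd_allowance W₁ i z₀ h𝔸 hlo' hoddA hβo γ₁ hs hs' hy)
    hα hβ hlam hε P1 P2 P3 P4 P4c P4d P5 P6 P7 P8

end Summit.AnomalousDissipation.AnomalousDissipation.Theorems.SolenoidalFractalHomogenisation.LagrangianStep.Sideband

end
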